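import Summits.QuantumAdvantage.AdviceFreeQNC0.CodegTwoPlanes
import Summits.QuantumAdvantage.AdviceFreeQNC0.PlanesStarTop
import Summits.QuantumAdvantage.AdviceFreeQNC0.LiftFromTransversal
import HarnessLib

/-!
# Cell qa-qnc0 (rung F-S1, route RingFrame, crux α, line `tensor`): THEOREM E2, SHARP FORM —
# `costBoundCodegTwo : CostBoundCodegTwo` (qn-p2 ROUND-5 §2.2 / Sketch5 verbatim: cost `≤ (3d+11)·2^L`)

The transversal number of a light row system modulo `RM(d, d+3)` is `≤ 6m + 4` (`m = d + 3`):

* the row-syndrome space `V` (`CodegTwo.V`) splits as `K ⊕ C`, `K` = kernel of the parity/point-sum map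
  (`kerV`), `dim C ≤ m + 1`; `C` costs `≤ 4` columns per basis vector (its leaders);
* every non-zero `k ∈ K` is the syndrome of a zero-sum quadruple `p + S(k)`, `S(k)` a PLANE whose four
  points THROUGH THE ORIGIN also represent `k` (`Syndrome2.indF_add_indF_planePts_mem_lowDeg`); distinct
  `k` give distinct planes, and two such planes MEET in a line (`finrank_inf_eq_one`: complementary planes
  would make `momMat (k + k') = B(S) + B(S')` of rank `4`, `Syndrome2.four_le_rank_bform_add`, against
  `rank ≤ 2` on `K`) — so by the literature seat's `planes_star_or_top` they form a STAR (common `c ≠ 0`)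
  or a TOP (inside a `3`-space `T`);
* STAR: each basis plane is `{0, c, t_i, t_i + c}`, so the union of the basis planes has `≤ 2 + 2·dim K`
  points, and `dim K ≤ m − 1` (`finrank_kerV_le_of_star`: `k ↦ momMat k · e₀ mod ⟨c⟩`, `c·e₀ = 1`, is
  injective); TOP: all basis planes lie in the `≤ 8` points of `T`.  Hence `#Z ≤ 2m + 4(m+1) = 6m + 4`
  for `m ≥ 4` (`d = 0`: `#Z ≤ 2^3 = 8 ≤ 22` trivially), and `exists_lift_of_transversal` gives the lift.

The cell's theorem (planner qa-qnc0-p2 gen 5 ROUND-5 §2.2, ask R5-a verbatim; the clique step is done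
ALGEBRAICALLY, without the Kasami–Tokura gap; prover qa-qnc0-prover gen 6, 2026-08-27).
WHAT THIS IS NOT: nothing on co-degree `≥ 3`, `LiftOneU`, α or the separation.
-/

noncomputable section

namespace Summit.QuantumAdvantage.AdviceFreeQNC0

open Finset Module Matrix
open Literature.Computability.MetaComplexity Literature.Computability.MetaComplexity.Smolensky
open MeanLoad Syndrome2 CodegTwo LiftFromTransversal

/-- **THEOREM E2, sharp form** (qn-p2 ROUND-5 §2.2, `Sketch5.CostBoundCodegTwo` verbatim): co-degree 2,
radius `w ≤ 4`, cost `≤ (3d + 11)·2^L`. -/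
def CostBoundCodegTwo : Prop :=
  ∀ L d w : ℕ, w ≤ 4 → ∀ X Y : BMat L (d + 3), LinCols X → RowsDeg d Y → (∀ u, rowDist X Y u ≤ w) →
    ∃ W : BMat L (d + 3), LinCols W ∧ RowsDeg d W ∧ hw (xorM X W) ≤ (3 * d + 11) * 2 ^ L

namespace CodegTwoStar

variable {L d : ℕ} {X Y : BMat L (d + 3)} {w : ℕ}

/-! ### The kernel of the parity/point-sum map inside `V` -/

/-- the kernel `K ≤ V` of the parity/point-sum map. -/
def kerV (X : BMat L (d + 3)) : Submodule (ZMod 2) (V X) := LinearMap.ker (parity1.domRestrict (V X))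

/-- Membership in `kerV`: zero parity and zero point sums. -/
theorem mem_kerV_iff (s : V X) :
    s ∈ kerV X ↔ (s : Finset (Fin (d + 3)) → ZMod 2) ∅ = 0 ∧ ∀ i, (s : Finset (Fin (d + 3)) → ZMod 2) {i} = 0 := by
  unfold kerV
  rw [LinearMap.mem_ker, LinearMap.domRestrict_apply]
  constructor
  · intro h
    exact ⟨congrFun h none, fun i => congrFun h (some i)⟩
  · rintro ⟨h0, h1⟩
    funext o
    cases o with
    | none => exact h0
    | some i => exact h1 i

/-- A kernel element is the syndrome of a leader of even size and zero point-sum. -/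
theorem exists_leader_of_mem_kerV (hX : LinCols X) (hY : RowsDeg d Y) {s : V X} (hs : s ∈ kerV X) :
    ∃ u, (s : _) = syn2 (indF (leader X Y u)) ∧ Even (leader X Y u).card ∧
      ∀ i, ∑ v ∈ leader X Y u, bvec v i = 0 := by
  rw [mem_kerV_iff] at hs
  obtain ⟨u, hu⟩ := exists_row_of_mem_V hX s.2
  refine ⟨u, by rw [← syn2_rowZ hY u, hu], ?_, fun i => ?_⟩
  · have h0 := hs.1
    rw [← hu, syn2_rowZ hY u, syn2_indF_empty] at h0
    exact (ZMod.natCast_eq_zero_iff_even).1 h0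
  · have h := hs.2 i
    rw [← hu, syn2_rowZ hY u, syn2_indF_singleton] at h
    exact h

/-- On the kernel the moment matrix has rank `≤ 2`. -/
theorem rank_momMat_le_two_of_mem_kerV (hX : LinCols X) (hY : RowsDeg d Y) (hdist : ∀ u, rowDist X Y u ≤ w)
    (hw4 : w ≤ 4) {s : V X} (hs : s ∈ kerV X) : (momMat (s : Finset (Fin (d + 3)) → ZMod 2)).rank ≤ 2 := by
  obtain ⟨u, hu, heven, hσ⟩ := exists_leader_of_mem_kerV hX hY hs
  rw [hu, momMat_syn2_indF]
  exact rank_momMat_le_two _ ((hdist u).trans hw4) heven hσ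

/-- **Plane data of a non-zero kernel element**: `momMat k = B(x,y)` and the plane `{0, x, y, x+y}`
through the origin represents `k`. -/
theorem exists_plane (hX : LinCols X) (hY : RowsDeg d Y) (hdist : ∀ u, rowDist X Y u ≤ w) (hw4 : w ≤ 4)
    {s : V X} (hs : s ∈ kerV X) (hne : s ≠ 0) :
    ∃ x y : Fin (d + 3) → ZMod 2, x ≠ 0 ∧ y ≠ 0 ∧ x ≠ y ∧
      momMat (s : Finset (Fin (d + 3)) → ZMod 2) = bform x y ∧
      syn2 (indF (planePts x y)) = (s : Finset (Fin (d + 3)) → ZMod 2) := by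
  obtain ⟨u, hu, heven, hσ⟩ := exists_leader_of_mem_kerV hX hY hs
  have h4 : (leader X Y u).card = 4 := by
    by_contra h
    have hle : (leader X Y u).card ≤ 4 := by rw [card_leader]; exact (hdist u).trans hw4
    have h3 : (leader X Y u).card ≤ 3 := by omega
    apply hne
    apply Subtype.ext
    rw [hu, eq_empty_of_card_le_three _ h3 heven hσ]
    have : indF (∅ : Finset (Fin (d + 3) → Bool)) = 0 := by funext v; simp [indF]
    rw [this, map_zero]
    rfl
  obtain ⟨p, _, x, y, hx, hy, hxy, hB, ha⟩ := quad_structure (leader X Y u) h4 hσ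
  refine ⟨x, y, hx, hy, hxy, by rw [hu, hB], ?_⟩
  have hker : indF (leader X Y u) + indF (planePts x y) ∈ LinearMap.ker (syn2 (m := d + 3)) := by
    rw [ker_syn2_eq_lowDeg]
    have h := indF_add_indF_planePts_mem_lowDeg (m := d + 3) (by omega) hx hy hxy ha
    rwa [show d + 3 - 3 = d by omega] at h
  rw [LinearMap.mem_ker, map_add] at hker
  have key : ∀ a b : Finset (Fin (d + 3)) → ZMod 2, a + b = 0 → b = a := by
    intro a b hab
    funext J
    have := congrFun hab J
    rw [Pi.add_apply, Pi.zero_apply] at this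
    have h2 : ∀ s t : ZMod 2, s + t = 0 → t = s := by decide
    exact h2 _ _ this
  rw [hu]
  exact key _ _ hker

/-! ### The planes of the non-zero kernel elements: a clique -/

section Planes

variable (X Y) (hX : LinCols X) (hY : RowsDeg d Y) (hdist : ∀ u, rowDist X Y u ≤ w) (hw4 : w ≤ 4)

/-- index type: the non-zero kernel elements. -/
abbrev KIdx (X : BMat L (d + 3)) := {s : V X // s ∈ kerV X ∧ s ≠ 0}

/-- first generator of the plane of `k`. -/
def px (k : KIdx X) : Fin (d + 3) → ZMod 2 := Classical.choose (exists_plane hX hY hdist hw4 k.2.1 k.2.2)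

/-- second generator of the plane of `k`. -/
def py (k : KIdx X) : Fin (d + 3) → ZMod 2 :=
  Classical.choose (Classical.choose_spec (exists_plane hX hY hdist hw4 k.2.1 k.2.2))

/-- the specification of the generators. -/
theorem pxy_spec (k : KIdx X) :
    px X Y hX hY hdist hw4 k ≠ 0 ∧ py X Y hX hY hdist hw4 k ≠ 0 ∧ px X Y hX hY hdist hw4 k ≠ py X Y hX hY hdist hw4 k ∧
      momMat ((k : V X) : Finset (Fin (d + 3)) → ZMod 2) = bform (px X Y hX hY hdist hw4 k) (py X Y hX hY hdist hw4 k) ∧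
      syn2 (indF (planePts (px X Y hX hY hdist hw4 k) (py X Y hX hY hdist hw4 k))) =
        ((k : V X) : Finset (Fin (d + 3)) → ZMod 2) :=
  Classical.choose_spec (Classical.choose_spec (exists_plane hX hY hdist hw4 k.2.1 k.2.2))

/-- the plane `S(k) = span{x_k, y_k}`. -/
def plane (k : KIdx X) : Submodule (ZMod 2) (Fin (d + 3) → ZMod 2) :=
  Submodule.span (ZMod 2) (Set.range ![px X Y hX hY hdist hw4 k, py X Y hX hY hdist hw4 k])

/-- `dim S(k) = 2`. -/
theorem finrank_plane (k : KIdx X) : finrank (ZMod 2) (plane X Y hX hY hdist hw4 k) = 2 := by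
  obtain ⟨hx, hy, hxy, -, -⟩ := pxy_spec X Y hX hY hdist hw4 k
  exact finrank_span_pair hx hy hxy

/-- **Distinct kernel elements have distinct planes** (the plane through `0` represents `k`). -/
theorem plane_injective {k k' : KIdx X} (h : plane X Y hX hY hdist hw4 k = plane X Y hX hY hdist hw4 k') : k = k' := by
  obtain ⟨-, -, -, -, hk⟩ := pxy_spec X Y hX hY hdist hw4 k
  obtain ⟨-, -, -, -, hk'⟩ := pxy_spec X Y hX hY hdist hw4 k'
  have hpts : planePts (px X Y hX hY hdist hw4 k) (py X Y hX hY hdist hw4 k) =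
      planePts (px X Y hX hY hdist hw4 k') (py X Y hX hY hdist hw4 k') := by
    ext v
    rw [mem_planePts_iff, mem_planePts_iff]
    show bvec v ∈ plane X Y hX hY hdist hw4 k ↔ bvec v ∈ plane X Y hX hY hdist hw4 k'
    rw [h]
  apply Subtype.ext
  apply Subtype.ext
  rw [← hk, ← hk', hpts]

/-- **The planes pairwise meet in a line** (algebraic clique lemma). -/
theorem finrank_inf_eq_one (k k' : KIdx X) (hne : plane X Y hX hY hdist hw4 k ≠ plane X Y hX hY hdist hw4 k') :
    finrank (ZMod 2) ↥(plane X Y hX hY hdist hw4 k ⊓ plane X Y hX hY hdist hw4 k') = 1 := by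
  obtain ⟨hx, hy, hxy, hB, -⟩ := pxy_spec X Y hX hY hdist hw4 k
  obtain ⟨hx', hy', hxy', hB', -⟩ := pxy_spec X Y hX hY hdist hw4 k'
  haveI : FiniteDimensional (ZMod 2) (plane X Y hX hY hdist hw4 k) :=
    Module.finite_of_finrank_eq_succ (finrank_plane X Y hX hY hdist hw4 k)
  -- at most a line: otherwise the planes coincide
  have hle : finrank (ZMod 2) ↥(plane X Y hX hY hdist hw4 k ⊓ plane X Y hX hY hdist hw4 k') ≤ 1 := by
    by_contra hgt
    have h2 : finrank (ZMod 2) (plane X Y hX hY hdist hw4 k) ≤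
        finrank (ZMod 2) ↥(plane X Y hX hY hdist hw4 k ⊓ plane X Y hX hY hdist hw4 k') := by
      rw [finrank_plane]; omega
    have heq : plane X Y hX hY hdist hw4 k ⊓ plane X Y hX hY hdist hw4 k' = plane X Y hX hY hdist hw4 k :=
      Submodule.eq_of_le_of_finrank_le inf_le_left h2
    have hle' : plane X Y hX hY hdist hw4 k ≤ plane X Y hX hY hdist hw4 k' := by
      rw [← heq]; exact inf_le_right
    haveI : FiniteDimensional (ZMod 2) (plane X Y hX hY hdist hw4 k') :=
      Module.finite_of_finrank_eq_succ (finrank_plane X Y hX hY hdist hw4 k')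
    exact hne (Submodule.eq_of_le_of_finrank_eq hle'
      (by rw [finrank_plane, finrank_plane]))
  -- at least a line: complementary planes give rank 4
  have hge : 1 ≤ finrank (ZMod 2) ↥(plane X Y hX hY hdist hw4 k ⊓ plane X Y hX hY hdist hw4 k') := by
    by_contra hlt
    have hbot : plane X Y hX hY hdist hw4 k ⊓ plane X Y hX hY hdist hw4 k' = ⊥ := by
      rw [← Submodule.finrank_eq_zero]; omega
    have hind := linearIndependent_four hx hy hxy hx' hy' hxy' hbot
    have h4 := four_le_rank_bform_add hind
    -- `B + B' = momMat (k + k')`, of rank ≤ 2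
    have hsum : bform (px X Y hX hY hdist hw4 k) (py X Y hX hY hdist hw4 k) +
        bform (px X Y hX hY hdist hw4 k') (py X Y hX hY hdist hw4 k') =
        momMat (((k : V X) + (k' : V X) : V X) : Finset (Fin (d + 3)) → ZMod 2) := by
      rw [← hB, ← hB', Submodule.coe_add, map_add]
    rw [hsum] at h4
    have h2 := rank_momMat_le_two_of_mem_kerV hX hY hdist hw4 ((kerV X).add_mem k.2.1 k'.2.1)
    omega
  omega

/-- **STAR or TOP** for the kernel planes. -/
theorem star_or_top :
    (∃ c : Fin (d + 3) → ZMod 2, c ≠ 0 ∧ ∀ k : KIdx X, c ∈ plane X Y hX hY hdist hw4 k) ∨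
      (∃ T : Submodule (ZMod 2) (Fin (d + 3) → ZMod 2), FiniteDimensional (ZMod 2) T ∧
        finrank (ZMod 2) T ≤ 3 ∧ ∀ k : KIdx X, plane X Y hX hY hdist hw4 k ≤ T) :=
  planes_star_or_top (plane X Y hX hY hdist hw4) (finrank_plane X Y hX hY hdist hw4)
    fun k k' hne => finrank_inf_eq_one X Y hX hY hdist hw4 k k' hne

/-! ### In the STAR case the kernel has dimension `≤ m − 1` -/

/-- `M ↦ M·e₀` as a linear map of the matrix. -/
def evalVec (e₀ : Fin (d + 3) → ZMod 2) : Matrix (Fin (d + 3)) (Fin (d + 3)) (ZMod 2) →ₗ[ZMod 2] (Fin (d + 3) → ZMod 2) where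
  toFun M := M *ᵥ e₀
  map_add' M N := Matrix.add_mulVec M N e₀
  map_smul' a M := Matrix.smul_mulVec a M e₀

/-- **STAR ⇒ `dim K ≤ m − 1`**: with `c·e₀ = 1`, `k ↦ momMat k · e₀ mod ⟨c⟩` is injective on `K`
(for `k ≠ 0`, `momMat k · e₀ = (y·e₀) x + (x·e₀) y` with `c ∈ {x, y, x+y}` is not in `{0, c}`). -/
theorem finrank_kerV_le_of_star {c : Fin (d + 3) → ZMod 2} (hc : c ≠ 0)
    (hstar : ∀ k : KIdx X, c ∈ plane X Y hX hY hdist hw4 k) :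
    finrank (ZMod 2) (kerV X) ≤ d + 2 := by
  classical
  -- a coordinate where `c` is `1`
  obtain ⟨i₀, hi₀⟩ : ∃ i, c i = 1 := by
    by_contra h
    push Not at h
    apply hc
    funext i
    have h01 : ∀ z : ZMod 2, z ≠ 1 → z = 0 := by decide
    exact h01 _ (h i)
  set e₀ : Fin (d + 3) → ZMod 2 := Pi.single i₀ 1 with he₀
  have hdot : ∀ v : Fin (d + 3) → ZMod 2, v ⬝ᵥ e₀ = v i₀ := fun v => by
    rw [he₀, dotProduct_single, mul_one]
  set ψ : kerV X →ₗ[ZMod 2] (Fin (d + 3) → ZMod 2) ⧸ Submodule.span (ZMod 2) {c} :=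
    (Submodule.span (ZMod 2) {c}).mkQ ∘ₗ (evalVec e₀) ∘ₗ momMat ∘ₗ (V X).subtype ∘ₗ (kerV X).subtype with hψ
  have hinj : Function.Injective ψ := by
    rw [← LinearMap.ker_eq_bot, Submodule.eq_bot_iff]
    intro k hk
    rw [LinearMap.mem_ker] at hk
    by_contra hk0
    have hk0' : (k : V X) ≠ 0 := fun h => hk0 (Subtype.ext h)
    let kk : KIdx X := ⟨k, k.2, hk0'⟩
    obtain ⟨hx, hy, hxy, hB, -⟩ := pxy_spec X Y hX hY hdist hw4 kk
    set x := px X Y hX hY hdist hw4 kk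
    set y := py X Y hX hY hdist hw4 kk
    have hcmem : c ∈ plane X Y hX hY hdist hw4 kk := hstar kk
    have hval : ψ k = Submodule.Quotient.mk (bform x y *ᵥ e₀) := by
      simp only [hψ, LinearMap.comp_apply, Submodule.subtype_apply, Submodule.mkQ_apply]
      rw [show ((kk : V X) : Finset (Fin (d + 3)) → ZMod 2) = ((k : V X) : _) from rfl] at hB
      rw [show (evalVec e₀) (momMat ((k : V X) : Finset (Fin (d + 3)) → ZMod 2)) = bform x y *ᵥ e₀ by
        rw [hB]; rfl]
    rw [hval, Submodule.Quotient.mk_eq_zero, bform_mulVec, hdot, hdot, Submodule.mem_span_singleton] at hk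
    obtain ⟨a, ha⟩ := hk
    have hind := linearIndependent_pair hx hy hxy
    -- coordinates with respect to the basis `(x, y)` are unique
    have coords : ∀ s t s' t' : ZMod 2, s • x + t • y = s' • x + t' • y → s = s' ∧ t = t' := by
      intro s t s' t' h
      have h0 : (s + s') • x + (t + t') • y = 0 := by
        rw [add_smul, add_smul]
        have e : s • x + s' • x + (t • y + t' • y) = (s • x + t • y) + (s' • x + t' • y) := by abel
        rw [e, h, add_self_vec]
      have h01 := (LinearIndependent.pair_iff.1 hind) _ _ h0
      have key : ∀ u v : ZMod 2, u + v = 0 → u = v := by decide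
      exact ⟨key _ _ h01.1, key _ _ h01.2⟩
    have hci : c i₀ = 1 := hi₀
    unfold plane at hcmem
    rw [mem_span_pair_iff] at hcmem
    rcases hcmem with hc0 | hcx | hcy | hcxy
    · exact hc hc0
    · -- `c = x`: compare the `y`-coordinates
      rw [hcx] at ha hci
      have h := coords a 0 (y i₀) (x i₀) (by rw [zero_smul, add_zero]; exact ha)
      have hxi : x i₀ = 1 := hci
      rw [hxi] at h
      exact absurd h.2 (by decide)
    · -- `c = y`: compare the `x`-coordinates
      rw [hcy] at ha hci
      have h := coords 0 a (y i₀) (x i₀) (by rw [zero_smul, zero_add]; exact ha)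
      have hyi : y i₀ = 1 := hci
      rw [hyi] at h
      exact absurd h.1 (by decide)
    · -- `c = x + y`: the coordinates of the value are equal, those of `c` sum to `1`
      rw [hcxy] at ha hci
      have h := coords a a (y i₀) (x i₀) (by rw [← smul_add]; exact ha)
      have hsum : x i₀ + y i₀ = 1 := hci
      rw [← h.1, ← h.2, CharTwo.add_self_eq_zero] at hsum
      exact absurd hsum (by decide)
  have h1 : finrank (ZMod 2) ((Fin (d + 3) → ZMod 2) ⧸ Submodule.span (ZMod 2) {c}) = d + 2 := by
    have h := (Submodule.span (ZMod 2) ({c} : Set (Fin (d + 3) → ZMod 2))).finrank_quotient_add_finrank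
    rw [finrank_span_singleton hc, Module.finrank_fintype_fun_eq_card, Fintype.card_fin] at h
    omega
  rw [← h1]
  exact LinearMap.finrank_le_finrank_of_injective hinj

end Planes

end CodegTwoStar

end Summit.QuantumAdvantage.AdviceFreeQNC0

end
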